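import Literature.AnabelianGeometry.EtaleTheta.Discharge.Sec2ModelKummerLifting
import Literature.AnabelianGeometry.EtaleTheta.Discharge.Sec2HcommOfSetting
import HarnessLib

/-!
# [EtTh] Cor. 2.19 (i), (ii) for the §1 MODEL with Prop. 2.14 (i) discharged (via abc-iut-L5-t14's
# `rigidData_prop214_i`): residual inputs = interface facts + Cor. 2.18 (i)/(iv)-surjectivity +
# the §1 origin hypotheses

Mochizuki, *The Étale Theta Function …* [EtTh], Publ. RIMS 45 (2009), §2, Cor. 2.19 (i), (ii)
pp.64–66 (locators `p.N` = PDF pages of the PRIMS text; bib key `MochizukiEtTh2009`). PROOF-ONLY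
(no `def`, no new named fact; seat abc-iut-L2-d1, DAG node `EtTh:Cor2.19`, LONG-CHAINS lane C2).
Continuation of `Sec2ModelKummerLifting.lean`: there, Cor. 2.19 (ii) for abc-iut-L2-t8's model tower was
reduced to temp-slimness of `Π^tp_X`, openness of `Π^tp_X → G_K`, and the level-wise named facts
`Cor218_iv_surjective` and `Prop214_i` of the instantiated rigidity data. abc-iut-L5-t14's
`DoubleUnderline.rigidData_prop214_i` (`Sec2HcommOfSetting.lean`, item N8: the Heisenberg description of
`l·Δ_Θ`, with `G_K` centre-free now a theorem) proves `Prop214_i` for the model from the §1 origin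
hypothesis `IsEtThOrigin` ("`Δ_X` is a profinite free group on 2 generators", p.12) and the p.12–13
sentences "`(Δ^tp_Y)^Θ` abelian" (`hYab`) / "… profinite" (`hYcl`, in its `Π_X`-side form). Here the two
are composed:

* `cor219_ii_model_of_origin` — Cor. 2.19 (ii) for the model tower ⟸ { `IsSlimGroup Π^tp_X`,
  `IsOpenMap aug`, ∀ `M`: `Cor218_iv_surjective` of `rigidData` (⟸ Cor. 2.18 (i) + constant multiple
  rigidity, FACT-policy), `IsEtThOrigin`, `hYab`, `hYcl` } (besides the data `D E C τ L` and
  `Compat`, `Sec2Hyps`, `Prop15iii`);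
* `cor219_i_splittings_model_of_origin` — Cor. 2.19 (i) (compatibility with the splittings) for the
  model ⟸ { Cor. 2.18 (i), `IsSlimGroup Π^tp_X`, `IsEtThOrigin`, `hYab`, `hYcl` }.

HONEST FRAMING: conditional discharge modulo the inputs listed; no side is taken on [IUTchIII]
Cor. 3.12; typed ≠ discharged elsewhere.
-/

noncomputable section

namespace Literature.AnabelianGeometry.EtaleTheta

open Literature.AnabelianGeometry.SemiGraphs
open Literature.AlgebraicGeometry.Frobenioids (IsSlimGroup)

namespace ThetaSetting.EtaleThetaData.DoubleUnderline

variable {p : ℕ} [Fact p.Prime] {D : ThetaSetting p} {E : D.EtaleThetaData} {l : ℕ}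
  (C : E.DoubleUnderline l) {Es : Set ℕ+} (τ : D.CyclotomeTower l Es)

/-- **Cor. 2.19 (ii) (discrete rigidity) for the §1 MODEL tower, Prop. 2.14 (i) discharged**: "any
projective system of mono-theta environments is isomorphic to the natural one" (p.64) HOLDS for
`thetaEnvTower C τ hC hS`, given temp-slimness of `Π^tp_X` (`hslimX`), openness of `Π^tp_X → G_K`
(`haugOpen`), Cor. 2.18 (iv)-surjectivity of the instantiated rigidity data at every level (`hlift`),
and the §1 origin hypotheses `IsEtThOrigin`, `hYab` ("`(Δ^tp_Y)^Θ` abelian", p.12), `hYcl`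
("`(Δ^tp_Y)^Θ` profinite", p.12, `Π_X`-side form) through abc-iut-L5-t14's `rigidData_prop214_i`.
[cite: MochizukiEtTh2009, Cor 2.19 (ii) p.64] -/
theorem cor219_ii_model_of_origin (hC : D.Compat) (hS : D.Sec2Hyps) (h15 : Prop15iii E hC)
    (L : C.CuspLabels) (hslimX : IsSlimGroup D.PiTemp) (haugOpen : IsOpenMap D.aug)
    (hlift : ∀ M : Es, (C.rigidData (τ.mod M) hC hS h15 L).Cor218_iv_surjective)
    (hO : D.IsEtThOrigin) (hYab : ∀ x ∈ D.DtpYTheta, ∀ y ∈ D.DtpYTheta, x * y = y * x)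
    (hYcl : (D.DtpY.map D.toHat.toMonoidHom).topologicalClosure ≤
      D.DtpY.map D.toHat.toMonoidHom ⊔ (⁅⁅D.DeltaHat, D.DeltaHat⁆, D.DeltaHat⁆).topologicalClosure) :
    (C.thetaEnvTower τ hC hS).Cor219_ii :=
  C.cor219_ii_model_of_rigid τ hC hS h15 L hslimX haugOpen hlift
    fun M => C.rigidData_prop214_i (τ.mod M) hC hS h15 L hO hYab hYcl

variable {N : ℕ+} (μ : D.CyclotomeMod l N)

/-- **Cor. 2.19 (i), splittings (cyclotomic rigidity), for the §1 MODEL, Prop. 2.14 (i) discharged**: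
every automorphism of the model mono-theta environment of `X̲̲` at level `N` is compatible with the two
splittings of `(l·Δ_Θ)[μ_N] ↠ (l·Δ_Θ)`, given Cor. 2.18 (i) for the instantiated rigidity data
(FACT-policy), temp-slimness of `Π^tp_X`, and the §1 origin hypotheses `IsEtThOrigin`, `hYab`, `hYcl`.
[cite: MochizukiEtTh2009, Cor 2.19 (i) p.64] -/
theorem cor219_i_splittings_model_of_origin (hC : D.Compat) (hS : D.Sec2Hyps) (h15 : Prop15iii E hC)
    (L : C.CuspLabels) (hslimX : IsSlimGroup D.PiTemp)
    (h218i : (C.rigidData μ hC hS h15 L).Cor218_i)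
    (hO : D.IsEtThOrigin) (hYab : ∀ x ∈ D.DtpYTheta, ∀ y ∈ D.DtpYTheta, x * y = y * x)
    (hYcl : (D.DtpY.map D.toHat.toMonoidHom).topologicalClosure ≤
      D.DtpY.map D.toHat.toMonoidHom ⊔ (⁅⁅D.DeltaHat, D.DeltaHat⁆, D.DeltaHat⁆).topologicalClosure) :
    (C.rigidData μ hC hS h15 L).Cor219_i_splittings :=
  C.cor219_i_splittings_model μ hC hS h15 L hslimX h218i
    (C.rigidData_prop214_i μ hC hS h15 L hO hYab hYcl)

end ThetaSetting.EtaleThetaData.DoubleUnderline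

end Literature.AnabelianGeometry.EtaleTheta

end
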